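import Mathlib
import HarnessLib
import Summits.HubbardSuperconductivity.HubbardSuperconductivity.Theorems.KLProgrammeKLRegimeEngineV8E5PointAugmentOverlap

/-!
# Route `KLProgramme` — ENGINE child gen 8 (stmt-HubbardSuperconductivity-20437 `KLRegimeEngineV17F2`), SKELETON v2 class #3, (RA-U) SUPPLIER part 4,
# input 3 — MODEL INSTANCE: the point-augmented overlap rows `(cr⁺, cc⁺)` for `(klAnisoFamily J′; klAnisoFamily (m+1), bgmFatMultiplier (m+1))`
# (cell gate-hubbard-kl, seat p5 g14; memo HOME/prover-p5/g11/RA-U-SUPPLY-g11.md §7.3 item 3; companion of `…E5PointAugmentOverlap`)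

The generic transfer `rowSum_overlap_pointAugment_le` / `colSum_overlap_pointAugment_le` (…E5PointAugmentOverlap §3) read four family facts; here they are
discharged for the model's thin/fat families at ANY frame `K`, any `β > 0`, any levels `J′`, `m+1` and any point momenta `e : Fin q → FreqMomentum`:
`‖F‖ ≤ 1` (`norm_klAnisoFamily_le_one`), thin multiplicity `ρ′ = 1` (`sum_norm_klAnisoFamily_le_one`: `Σ_ω ‖F_ω(k)‖ = C_h⁻¹(k) ≤ 1`),
`‖1 − Σ_ω F_ω‖ ≤ 1`, `‖F̃‖ ≤ 1` (`norm_bgmFatMultiplier_le_one`), fat multiplicity `ρ₁ = 9` (`card_filter_bgmFat_ne_zero_le_nine`, from k3c2-p3's overlap count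
`card_overlap_bgmFat_le_nine`), and the currency identity `‖(βL²)⁻¹‖·|SpaceTimeIdx| = (imagTimeWeight β M)⁻¹` (`overlapEpsInv_eq`).  Result:

* **`overlapRows_pointAugment_klAniso_bgmFat`** — PLAIN overlap rows `(cr, cc)` of `E(klAnisoFamily J′)·S(bgmFatMultiplier (m+1))` ⟹ on the augmented pair
  `(pointAugment (klAnisoFamily J′) e, pointAugmentFat (klAnisoFamily (m+1)) (bgmFatMultiplier (m+1)) e)`:
  `hrow′` with `cr⁺ = cr + (9 + q)·(imagTimeWeight β M)⁻¹` and `hcol′` with `cc⁺ = cc + (1 + q)·(imagTimeWeight β M)⁻¹`, in EXACTLY the shapes read by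
  `carrier_smearTotal_firstOrder_le` / `carrier_increment_ordersGe2_le` / `carrier_smearSoft_firstOrder_le` (…E5CarrierDoors; there `q = 4`,
  `e = klE5ExtMomenta Qm x y`, `K = klFlowFrameU … n`, `(J′, m+1) ∈ {(n−2, n−3), (n−2, n−4), (n−3, n−4)}`).  The plain `(cr, cc)` are the tower's (L2) overlap
  data (p3: `overlapWt_towerBlock_klEng_flow_deep`, `overlapWt_colSum_klEng_flow_deep`, weight `klScaleWt ≥ 1` by `one_le_klScaleWt`).

Everything is proved; no definitions; no named facts; nothing about the model's sizes is asserted; nothing asserts superconductivity.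
[cite: BenfattoGiulianiMastropietro2006, §2.5 (2.45), §2.7 (2.66), (2.71a)]
-/

noncomputable section

namespace Summit.HubbardSuperconductivity.HubbardSuperconductivity.Theorems.KLRegimeSplit

set_option linter.dupNamespace false -- summit = problem name (single-conjunct summit), D-0017

open Real Finset Literature.MathematicalPhysics.QuantumLattice Literature.Probability.LatticeModels Matrix
open Summit.HubbardSuperconductivity.HubbardSuperconductivity.Theorems.KLProgrammeLegKernels
open Summit.HubbardSuperconductivity.HubbardSuperconductivity.Theorems.KLRegimeWick
open Summit.HubbardSuperconductivity.HubbardSuperconductivity.Theorems.TorusFourierL2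

/-! ## §1 The currency identity -/

section Currency

variable {L M : ℕ} [NeZero L]


/-- **`‖(βL²)⁻¹‖·|SpaceTimeIdx| = ε⁻¹`** (`ε = imagTimeWeight β M = β/(2M)`, `β > 0`). [folklore] -/
theorem overlapEpsInv_eq [NeZero M] {β : ℝ} (hβ : 0 < β) :
    ‖((1 / (β * (L : ℝ) ^ 2) : ℝ) : ℂ)‖ * (Fintype.card (SpaceTimeIdx L M) : ℝ) = (imagTimeWeight β M)⁻¹ := by
  have hL : (0 : ℝ) < (L : ℝ) := by exact_mod_cast Nat.pos_of_ne_zero (NeZero.ne L)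
  have hβL : 0 < β * (L : ℝ) ^ 2 := by positivity
  have hcard := imagTimeWeight_mul_card β L M
  have hε : 0 < imagTimeWeight β M := by
    unfold imagTimeWeight
    have hM : (0 : ℝ) < (M : ℝ) := by exact_mod_cast Nat.pos_of_ne_zero (NeZero.ne M)
    positivity
  rw [Complex.norm_real, Real.norm_eq_abs, abs_of_pos (by positivity)]
  refine eq_inv_of_mul_eq_one_left ?_
  calc 1 / (β * (L : ℝ) ^ 2) * (Fintype.card (SpaceTimeIdx L M) : ℝ) * imagTimeWeight β M
      = (imagTimeWeight β M * Fintype.card (SpaceTimeIdx L M)) / (β * (L : ℝ) ^ 2) := by ring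
    _ = 1 := by rw [hcard, div_self hβL.ne']

end Currency

/-! ## §2 The model instance: `(klAnisoFamily J′; klAnisoFamily k, bgmFatMultiplier k)`, `k ≥ 1`, any frame, any point momenta -/

section Model

variable {L M : ℕ} [NeZero L] (β μ : ℝ) (K : TrigPolyC4v)

omit [NeZero L] in
/-- `‖F_ω(k)‖ ≤ 1` for the anisotropic family. [cite: BenfattoGiulianiMastropietro2006, §2.5 (2.45)] -/
theorem norm_klAnisoFamily_le_one (n : ℕ) (ω : Fin (sectorCount n)) (k : FreqMomentum L M) : ‖klAnisoFamily L M β μ K klE0 n ω k‖ ≤ 1 :=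
  norm_bgmMultiplier_le_one _ _ _ _ _ _

omit [NeZero L] in
/-- **Thin multiplicity `ρ′ = 1`**: `Σ_ω ‖F_ω(k)‖ = C_h⁻¹(k) ≤ 1` (the multipliers are a nonnegative resolution of the scale cutoff).
[cite: BenfattoGiulianiMastropietro2006, §2.5 (2.45)] -/
theorem sum_norm_klAnisoFamily_le_one (n : ℕ) (k : FreqMomentum L M) : ∑ ω, ‖klAnisoFamily L M β μ K klE0 n ω k‖ ≤ 1 := by
  have hre : ∀ ω : Fin (sectorCount n), ‖klAnisoFamily L M β μ K klE0 n ω k‖ = (klAnisoFamily L M β μ K klE0 n ω k).re := by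
    intro ω
    obtain ⟨r, hr, h⟩ := bgmMultiplier_mem klE0 β (nambuXiCT L μ K) n ω k
    rw [klAnisoFamily, h, Complex.norm_real, Complex.ofReal_re, Real.norm_eq_abs, abs_of_nonneg hr.1]
  simp_rw [hre]
  rw [← Complex.re_sum, klAnisoFamily, sum_bgmMultiplier, Complex.ofReal_re]
  exact (gnScaleCutoff_mem_Icc _ _ _ _).2

omit [NeZero L] in
/-- `‖1 − Σ_ω F_ω(k)‖ ≤ 1` (`Σ_ω F_ω = C_h⁻¹ ∈ [0,1]`). [cite: BenfattoGiulianiMastropietro2006, §2.5 (2.45)] -/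
theorem norm_one_sub_sum_klAnisoFamily_le_one (n : ℕ) (k : FreqMomentum L M) : ‖1 - ∑ ω, klAnisoFamily L M β μ K klE0 n ω k‖ ≤ 1 := by
  rw [klAnisoFamily, sum_bgmMultiplier, ← Complex.ofReal_one, ← Complex.ofReal_sub, Complex.norm_real, Real.norm_eq_abs]
  have h := gnScaleCutoff_mem_Icc 4 klE0 (-(n : ℤ)) (Real.sqrt (matsubaraFreq β M k.1 ^ 2 + nambuXiCT L μ K k.2 ^ 2))
  rw [abs_of_nonneg (by linarith [h.2])]
  linarith [h.1]

/-- **Fat multiplicity `ρ₁ = 9`** at every level `k ≥ 1`: at most `9` fat multipliers meet any momentum. [cite: BenfattoGiulianiMastropietro2006, §2.7 (2.66)] -/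
theorem card_filter_bgmFat_ne_zero_le_nine {k : ℕ} (hk : 1 ≤ k) (p : FreqMomentum L M) :
    ((univ : Finset (Fin (sectorCount k))).filter fun ω => bgmFatMultiplier L M klE0 β (nambuXiCT L μ K) k ω p ≠ 0).card ≤ 9 := by
  classical
  obtain ⟨m, rfl⟩ : ∃ m, k = m + 1 := ⟨k - 1, (Nat.sub_add_cancel hk).symm⟩
  have hρ₀ := card_overlap_bgmFat_le_nine (L := L) (M := M) (e₀ := klE0) (β := β) (μ := μ) (K := K) m
  exact card_filter_ne_zero_le_of_overlap _ (fun ω => by convert hρ₀ ω) p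

/-- **THE POINT-AUGMENTED OVERLAP ROWS OF THE MODEL** — input 3 of the (RA-U) supplier's part 4 (memo RA-U-SUPPLY-g11 §7.3): for the thin family
`F′ = klAnisoFamily … K klE0 J′` and the pair `(klAnisoFamily … k, bgmFatMultiplier … k)`, `k ≥ 1`, any frame `K`, `β > 0`, any point momenta `e : Fin q → _`,
PLAIN overlap rows `(cr, cc)` of `E(F′)·S(F̃_k)` give the `hrow′/hcol′` data of the carrier doors on the augmented pair:
`cr⁺ = cr + (9 + q)·(imagTimeWeight β M)⁻¹`, `cc⁺ = cc + (1 + q)·(imagTimeWeight β M)⁻¹`. [cite: BenfattoGiulianiMastropietro2006, §2.7 (2.71a)] -/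
theorem overlapRows_pointAugment_klAniso_bgmFat [NeZero M] {β : ℝ} (hβ : 0 < β) (μ : ℝ) (K : TrigPolyC4v) (J' : ℕ) {k : ℕ} (hk : 1 ≤ k) {q : ℕ}
    (e : Fin q → FreqMomentum L M) {cr cc : ℝ} (hcr0 : 0 ≤ cr) (hcc0 : 0 ≤ cc)
    (hcr : ∀ Y'' : SpaceTimeIdx L M × SectorLeg (sectorCount J'), ∑ Y' : SpaceTimeIdx L M × SectorLeg (sectorCount k),
      ‖(sectorAnalysisMatrix L M β (klAnisoFamily L M β μ K klE0 J') *
        sectorSubMatrix L M β (bgmFatMultiplier L M klE0 β (nambuXiCT L μ K) k)) Y'' Y'‖ ≤ cr)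
    (hcc : ∀ Y' : SpaceTimeIdx L M × SectorLeg (sectorCount k), ∑ Y'' : SpaceTimeIdx L M × SectorLeg (sectorCount J'),
      ‖(sectorAnalysisMatrix L M β (klAnisoFamily L M β μ K klE0 J') *
        sectorSubMatrix L M β (bgmFatMultiplier L M klE0 β (nambuXiCT L μ K) k)) Y'' Y'‖ ≤ cc) :
    (∀ X'' : SpaceTimeIdx L M × SectorLeg (sectorCount J' + q), ∑ X' : SpaceTimeIdx L M × SectorLeg (sectorCount k + q),
      ‖(sectorAnalysisMatrix L M β (pointAugment (klAnisoFamily L M β μ K klE0 J') e) *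
        sectorSubMatrix L M β (pointAugmentFat (klAnisoFamily L M β μ K klE0 k)
          (bgmFatMultiplier L M klE0 β (nambuXiCT L μ K) k) e)) X'' X'‖ ≤ cr + (9 + q) * (imagTimeWeight β M)⁻¹) ∧
    (∀ X' : SpaceTimeIdx L M × SectorLeg (sectorCount k + q), ∑ X'' : SpaceTimeIdx L M × SectorLeg (sectorCount J' + q),
      ‖(sectorAnalysisMatrix L M β (pointAugment (klAnisoFamily L M β μ K klE0 J') e) *
        sectorSubMatrix L M β (pointAugmentFat (klAnisoFamily L M β μ K klE0 k)
          (bgmFatMultiplier L M klE0 β (nambuXiCT L μ K) k) e)) X'' X'‖ ≤ cc + (1 + q) * (imagTimeWeight β M)⁻¹) := by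
  have hε : ‖((1 / (β * (L : ℝ) ^ 2) : ℝ) : ℂ)‖ * (Fintype.card (SpaceTimeIdx L M) : ℝ) = (imagTimeWeight β M)⁻¹ :=
    overlapEpsInv_eq (L := L) (M := M) hβ
  refine ⟨fun X'' => ?_, fun X' => ?_⟩
  · have h := rowSum_overlap_pointAugment_le β (klAnisoFamily L M β μ K klE0 J') (klAnisoFamily L M β μ K klE0 k)
      (bgmFatMultiplier L M klE0 β (nambuXiCT L μ K) k) e (norm_klAnisoFamily_le_one β μ K J') (norm_one_sub_sum_klAnisoFamily_le_one β μ K J')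
      (norm_bgmFatMultiplier_le_one _ _ _ _) (card_filter_bgmFat_ne_zero_le_nine β μ K hk) hcr0 hcr X''
    rw [hε] at h
    convert h using 2
    push_cast
    ring
  · have h := colSum_overlap_pointAugment_le β (klAnisoFamily L M β μ K klE0 J') (klAnisoFamily L M β μ K klE0 k)
      (bgmFatMultiplier L M klE0 β (nambuXiCT L μ K) k) e (norm_klAnisoFamily_le_one β μ K J') (norm_one_sub_sum_klAnisoFamily_le_one β μ K J')
      zero_le_one (sum_norm_klAnisoFamily_le_one β μ K J') (norm_bgmFatMultiplier_le_one _ _ _ _) hcc0 hcc X'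
    rw [hε] at h
    exact h

/-- **The same under NESTING `J′ ≥ k + 1`** (the model's output family is finer than the input pair): the old-thin × point-fat block vanishes
(`overlap_pointAugment_augLeg_natAdd_eq_zero` with `EngineV8.sum_klAnisoFamily_eq_one_of_klAnisoFamily_ne_zero`) — recorded for the kit as the sharper row
constant on OLD rows, `cr⁺_old = cr` (point rows keep `(9 + q)·ε⁻¹`). [cite: BenfattoGiulianiMastropietro2006, §2.7 (2.71a)] -/
theorem rowSum_overlap_pointAugment_klAniso_augLeg_of_le {β : ℝ} (μ : ℝ) (K : TrigPolyC4v) {J' k : ℕ} (hkJ : k + 1 ≤ J') {q : ℕ}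
    (e : Fin q → FreqMomentum L M) {cr : ℝ}
    (hcr : ∀ Y'' : SpaceTimeIdx L M × SectorLeg (sectorCount J'), ∑ Y' : SpaceTimeIdx L M × SectorLeg (sectorCount k),
      ‖(sectorAnalysisMatrix L M β (klAnisoFamily L M β μ K klE0 J') *
        sectorSubMatrix L M β (bgmFatMultiplier L M klE0 β (nambuXiCT L μ K) k)) Y'' Y'‖ ≤ cr)
    (Y'' : SpaceTimeIdx L M × SectorLeg (sectorCount J')) :
    ∑ X' : SpaceTimeIdx L M × SectorLeg (sectorCount k + q),
      ‖(sectorAnalysisMatrix L M β (pointAugment (klAnisoFamily L M β μ K klE0 J') e) *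
        sectorSubMatrix L M β (pointAugmentFat (klAnisoFamily L M β μ K klE0 k)
          (bgmFatMultiplier L M klE0 β (nambuXiCT L μ K) k) e)) (augLeg Y'') X'‖ ≤ cr := by
  have hpl : ∀ (ω : Fin (sectorCount J')) (p : FreqMomentum L M), klAnisoFamily L M β μ K klE0 J' ω p ≠ 0 →
      ∑ ω₀, klAnisoFamily L M β μ K klE0 k ω₀ p = 1 :=
    fun ω p h => EngineV8.sum_klAnisoFamily_eq_one_of_klAnisoFamily_ne_zero β μ K hkJ ω p h
  rw [sum_sectorLegAug_split]
  have h0 : ∑ x' : SpaceTimeIdx L M, ∑ j' : Fin q, ∑ σ : Fin 2, ∑ c : Fin 2,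
      ‖(sectorAnalysisMatrix L M β (pointAugment (klAnisoFamily L M β μ K klE0 J') e) *
        sectorSubMatrix L M β (pointAugmentFat (klAnisoFamily L M β μ K klE0 k)
          (bgmFatMultiplier L M klE0 β (nambuXiCT L μ K) k) e)) (augLeg Y'') (x', ((Fin.natAdd (sectorCount k) j', σ), c))‖ = 0 := by
    refine sum_eq_zero fun x' _ => sum_eq_zero fun j' _ => sum_eq_zero fun σ _ => sum_eq_zero fun c _ => ?_
    rw [overlap_pointAugment_augLeg_natAdd_eq_zero β _ _ _ e hpl, norm_zero]
  rw [h0, add_zero]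
  simp only [overlap_pointAugment_augLeg_augLeg]
  exact hcr Y''

end Model

end Summit.HubbardSuperconductivity.HubbardSuperconductivity.Theorems.KLRegimeSplit

end
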